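import Literature.MathematicalPhysics.QuantumFieldTheory.ConformalBootstrap3D.PointKernelK34L515.Cert

/-!
# K34L515 instance, cell `l6c5` (parts file: groups 1:21,1:28)

Kernel-v3 cell of the point-functional exclusion instance for the lower box `Δσ ∈ [0.515, 0.520]`,
`Δε ∈ [0.6, 0.95)` (certificate `certL515`, module `PointKernelK34L515.Cert`): spin `ℓ = 6`,
`Δ ∈ [239/32, 15/2)` (centre `A`, half-width `2^-6`), Taylor degree `3`, `n_F = 50`, `2` s-piece(s)
covering `s = Δσ ∈ [103/200, 13/25]`.  Group theorems `l6c5_part<i>_<a>_<b> : gPart … = some <literal>` are checked by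
`decide +kernel` (the literals were produced by `#eval` of the same function); the cell numbers `l6c5_num<i> ≥ 0`
likewise; `l6c5_block` is `PKTM.blockPositive_of_cellPass` applied to them. This file holds only group theorems (the cell stated as a literal); the final file of the cell imports it.  Generated by
`gen/mk_v3cell.py` / `gen/drive_v3.py` (typer-g8).  [folklore]
-/

set_option Elab.async false

namespace Literature.MathematicalPhysics.QuantumFieldTheory.ConformalBootstrap3D

namespace PointKernelK34L515

open PointKernel PKTM
open Literature.Analysis.ValidatedNumerics.PolyMP
open Literature.Analysis.ValidatedNumerics.NumericsMP

/-- group model literal [folklore] -/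
def l6c5_g1_21_28 : G3 := ([⟨-893070701483954781645182485302654211303, -893070700480864067623945444439936745572⟩, ⟨1657601966443943885489144559725598455, 1657602744979340312994887715653771061⟩, ⟨-144197498841085353795734848847830755, -144196682519685930356573063333472780⟩, ⟨-4143654359316652131088642359445688660, -4143653635872490812870139503473204097⟩], [⟨4952799409646799182851772406101833232, 4952799414907587954882985659934490454⟩, ⟨-20118447305693115393618473698036242, -20118443125036262681830047479663960⟩, ⟨13203767113584831785913478612236403, 13203771515871373048909835073662325⟩, ⟨19304058782035883593181211586126067, 19304062702188540010445628639918767⟩], [⟨-13493938658181596358455926410563571, -13493938644320401796931192913310336⟩, ⟨28799574486337504705560477560966, 28799585669444413847865290517235⟩, ⟨-50896473704713429256350090805199, -50896461884628138806807781280365⟩, ⟨-47487248769688954964461869601755, -47487238200394472867548257724534⟩])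

/-- group model literal [folklore] -/
def l6c5_g1_28_34 : G3 := ([⟨486853064824122944482905418551801005483, 486853065911170112013921987878838247319⟩, ⟨16075654257774101694020100713892890492, 16075655087590165165501718010372386826⟩, ⟨2889398082165054053309109730813616716, 2889398953305402225257135030652256400⟩, ⟨2185348142167166887385171085986892660, 2185348922109148271470931671089506442⟩], [⟨-2863178113137741003783499963328119415, -2863178107027937584234424790856735322⟩, ⟨-121023428810976841331864067039663333, -121023424048676279379056860785276285⟩, ⟨-22320157964585380985496416415968834, -22320152950848985365412459182509428⟩, ⟨-10901307752953990801492275558473992, -10901303249931490141816818682939816⟩], [⟨8604773095891254862064172657881452, 8604773113310894891656740238612082⟩, ⟨452064180787050649981649265093984, 452064194531886382384221124330120⟩, ⟨69691567918655124706407099629468, 69691582430380253275519060449051⟩, ⟨30027279693783421228490099655527, 30027292767871611341725819294063⟩])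

/-- group `[21, 28)` of piece 1 [folklore] -/
theorem l6c5_part1_21_28 : gPart certL515 (⟨6, ((479 : ℚ) / 64), 6, 3, 50, 6, 64, ⟨3, 0, 5, 95, 0, 0⟩⟩ : TMCell) (pc ps2 1) 21 28 = some l6c5_g1_21_28 := by decide +kernel

/-- group `[28, 34)` of piece 1 [folklore] -/
theorem l6c5_part1_28_34 : gPart certL515 (⟨6, ((479 : ℚ) / 64), 6, 3, 50, 6, 64, ⟨3, 0, 5, 95, 0, 0⟩⟩ : TMCell) (pc ps2 1) 28 34 = some l6c5_g1_28_34 := by decide +kernel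

end PointKernelK34L515

end Literature.MathematicalPhysics.QuantumFieldTheory.ConformalBootstrap3D
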